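import Summits.AtomisticToContinuum.Crystallization.Theorems.ChartedPlanarOrderCleanStackedIndependent

/-!
# R1-N, N side: the pattern-scale window made PARAMETRIC — `IsCleanP aHi`, the door binders at scale `aHi`, and the two
# constant-consuming re-derivations (relative density and IND) at every `aHi ≤ 8/7` (decomp-a2c lens-3 g23, critic row 443 (A)(a))

Blocker `N = ChartedPlanarOrder.ChartedZeroExcessLayered`.  Critic rows 440 (3) / 443 (A): R1-N widens the two-shell pattern-scale window from
`a ∈ [9/10, 1]` to `[9/10, 103/100]` on both sides of the door (lens-4: `…OverbindingBudgetScaleWidening.IsCleanW / IsDoorSetW / DoorPeriodicW`, the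
literal `103/100`).  lens-3 g23 ANSWER: N's line is scale-covariant — `a ≤ 1` is load-bearing nowhere; the only two proofs that CONSUME the constant are
the relative-density step (`exists_closer_of_clean`, `exists_mem_dist_lt_five_of_clean`) and, through it, IND (`linearIndependent_of_clean_stacked`).
This module is the N-side half, stated ONCE for every scale ceiling `aHi ≤ 8/7` (the true slack of the constant `5`):
* §1 `IsCleanP aHi μ` (N's cleanliness binder with ceiling `aHi`; `IsCleanP 1 = IsClean` and lens-4's `IsCleanW = IsCleanP (103/100)` hold by
  `Iff.rfl`), `IsCleanChunkP`, `IsDoorSetP aHi δ S`, `DoorPeriodicP Λ aHi`, the `… 1 ↔ old` lemmas, monotonicity in `aHi`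
  (`IsCleanP` grows, `DoorPeriodicP Λ` shrinks: `DoorPeriodicP Λ aHi → DoorPeriodic Λ` for `1 ≤ aHi`);
* §2 RELATIVE DENSITY at ceiling `aHi ≤ 8/7`: `exists_closer_of_cleanP` (from an atom at distance `≥ 5` some two-shell neighbour is strictly closer —
  the record's arithmetic with `a ≤ 8/7` in place of `a ≤ 1`, threshold `5` unchanged and now NON-strict) ⇒ `exists_mem_dist_lt_five_of_cleanP`
  (every point of space is within distance `< 5` of a separated nonempty `aHi`-clean set; serves both `…WindowCounting` and IND consumers) and
  the descent inequality `cleanCovering_descent_ineqP` (`a ≤ 8/7 < 1.198`);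
* §3 IND from DENSITY ALONE: `linearIndependent_of_dense_stacked` (the record proof of `linearIndependent_of_clean_stacked` consumes cleanliness
  and separation only through `5`-relative density — restated with that density as the hypothesis, proof otherwise verbatim) ⇒
  `cleanStackedIndependentP (haHi : aHi ≤ 8/7)` in the binder order of `CleanStackedIndependent` with `IsClean ↦ IsCleanP aHi`.
Record proofs untouched (`[folklore]` re-derivations); no `sorry`, no new axioms, no `instance` / `notation`.
-/

noncomputable section

open MeasureTheory Set Metric
open scoped RealInnerProductSpace
open Literature.Geometry.DiscreteGeometry
open Summit.AtomisticToContinuum.Crystallization.Theorems.ChartedPlanarOrderRigidityDoor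
open Summit.AtomisticToContinuum.Crystallization.Theorems.ChartedPlanarOrderDensityDichotomy
open Summit.AtomisticToContinuum.Crystallization.Theorems.ChartedPlanarOrderMesoCut
open Summit.AtomisticToContinuum.Crystallization.Theorems.ChartedPlanarOrderProfileSlavingLJ (IsStacked)
open Summit.AtomisticToContinuum.Crystallization.Theorems.ChartedPlanarOrderDoorLayered (Layered DoorPeriodic TwoPeriodic)
open Summit.AtomisticToContinuum.Crystallization.Theorems.ChartedPlanarOrderNashForceBalance
open Summit.AtomisticToContinuum.Crystallization.Theorems.ChartedPlanarOrderCleanStackedIndependent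

namespace Summit.AtomisticToContinuum.Crystallization.Theorems.ChartedPlanarOrderCleanScaleP

/-! ## 1. The binders at pattern-scale ceiling `aHi` -/

/-- N's cleanliness binder with the pattern-scale window `[9/10, aHi]`: every atom `(1/16, 9/10, aHi)`-two-shell-good. -/
def IsCleanP (aHi : ℝ) (μ : Measure E3) : Prop :=
  ∀ q : EuclideanSpace ℝ (Fin 3), μ {q} ≠ 0 → IsTwoShellGoodSet (1 / 16) (9 / 10) aHi {p : EuclideanSpace ℝ (Fin 3) | μ {p} ≠ 0} q

/-- a finite chunk of `S` of `(1/16, 9/10, aHi)`-clean atoms. -/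
def IsCleanChunkP (aHi : ℝ) (S K : Set E3) : Prop :=
  K ⊆ S ∧ K.Finite ∧ ∀ x ∈ K, IsTwoShellGoodSet (1 / 16) (9 / 10) aHi S x

/-- door configuration at ceiling `aHi`: rooted, `δ`-separated, `aHi`-clean, Nash, charted (conjuncts in the order of `IsDoorSet`). -/
def IsDoorSetP (aHi δ : ℝ) (S : Set E3) : Prop :=
  (0 : E3) ∈ S ∧ IsSep δ S ∧ IsCleanP aHi (μS S) ∧ IsNash (μS S) ∧ IsCharted (μS S)

/-- the door's Liouville statement at ceiling `aHi`: every `aHi`-door configuration is two-periodic with periods `≤ Λ`. -/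
def DoorPeriodicP (Λ aHi : ℝ) : Prop :=
  ∀ δ : ℝ, 0 < δ → ∀ S : Set E3, IsDoorSetP aHi δ S → TwoPeriodic Λ S

/-- `IsCleanP 1` is N's `IsClean`. -/
theorem isCleanP_one_iff (μ : Measure E3) : IsCleanP 1 μ ↔ IsClean μ := Iff.rfl

/-- `IsCleanChunkP 1` is `IsCleanChunk`. -/
theorem isCleanChunkP_one_iff (S K : Set E3) : IsCleanChunkP 1 S K ↔ IsCleanChunk S K := Iff.rfl

/-- `IsDoorSetP 1` is `IsDoorSet`. -/
theorem isDoorSetP_one_iff (δ : ℝ) (S : Set E3) : IsDoorSetP 1 δ S ↔ IsDoorSet δ S := Iff.rfl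

/-- `DoorPeriodicP Λ 1` is `DoorPeriodic Λ`. -/
theorem doorPeriodicP_one_iff (Λ : ℝ) : DoorPeriodicP Λ 1 ↔ DoorPeriodic Λ := Iff.rfl

/-- the atoms of `μS S` are the points of `S`, so `IsCleanP aHi (μS S)` is goodness at every point of `S` inside `S`. -/
theorem isCleanP_μS_iff {aHi : ℝ} (S : Set E3) : IsCleanP aHi (μS S) ↔ ∀ q ∈ S, IsTwoShellGoodSet (1 / 16) (9 / 10) aHi S q := by
  unfold IsCleanP
  rw [setOf_μS_ne_zero]
  exact forall_congr' fun q => imp_congr (Literature.Probability.Process.count_restrict_singleton_ne_zero_iff S q) Iff.rfl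

/-- `IsCleanP` grows with the ceiling (goodness is monotone in `aHi`, cf. lens-4's `isTwoShellGoodSet_widen`). [folklore] -/
theorem isCleanP_mono {aHi aHi' : ℝ} (hle : aHi ≤ aHi') {μ : Measure E3} (h : IsCleanP aHi μ) : IsCleanP aHi' μ := fun q hq => by
  obtain ⟨a, ha₁, ha₂, rest⟩ := h q hq
  exact ⟨a, ha₁, ha₂.trans hle, rest⟩

/-- in particular `IsClean μ → IsCleanP aHi μ` for every `aHi ≥ 1`. -/
theorem isCleanP_of_isClean {aHi : ℝ} (hle : 1 ≤ aHi) {μ : Measure E3} (h : IsClean μ) : IsCleanP aHi μ :=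
  isCleanP_mono hle ((isCleanP_one_iff μ).2 h)

/-- `IsCleanChunkP` grows with the ceiling. -/
theorem isCleanChunkP_mono {aHi aHi' : ℝ} (hle : aHi ≤ aHi') {S K : Set E3} (h : IsCleanChunkP aHi S K) : IsCleanChunkP aHi' S K :=
  ⟨h.1, h.2.1, fun x hx => by obtain ⟨a, ha₁, ha₂, rest⟩ := h.2.2 x hx; exact ⟨a, ha₁, ha₂.trans hle, rest⟩⟩

/-- `IsDoorSetP` grows with the ceiling. -/
theorem isDoorSetP_mono {aHi aHi' δ : ℝ} (hle : aHi ≤ aHi') {S : Set E3} (h : IsDoorSetP aHi δ S) : IsDoorSetP aHi' δ S :=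
  ⟨h.1, h.2.1, isCleanP_mono hle h.2.2.1, h.2.2.2.1, h.2.2.2.2⟩

/-- `DoorPeriodicP Λ` SHRINKS with the ceiling (more door configurations to decide). -/
theorem doorPeriodicP_anti {Λ aHi aHi' : ℝ} (hle : aHi ≤ aHi') (h : DoorPeriodicP Λ aHi') : DoorPeriodicP Λ aHi :=
  fun δ hδ S hS => h δ hδ S (isDoorSetP_mono hle hS)

/-- in particular the widened door implies N's door: `DoorPeriodicP Λ aHi → DoorPeriodic Λ` for `aHi ≥ 1`. -/
theorem doorPeriodic_of_doorPeriodicP {Λ aHi : ℝ} (hle : 1 ≤ aHi) (h : DoorPeriodicP Λ aHi) : DoorPeriodic Λ :=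
  (doorPeriodicP_one_iff Λ).1 (doorPeriodicP_anti hle h)

/-! ## 2. Relative density at every ceiling `aHi ≤ 8/7` -/

section Density

variable {δ aHi : ℝ} {S : Set E3}

/-- the descent inequality of `…CleanCovering` at scale `a ≤ 8/7` (record: `a ≤ 1`; true up to `a < 1.1979` at `r ≥ 5`). [folklore] -/
theorem cleanCovering_descent_ineqP {a r d : ℝ} (ha1 : 9 / 10 ≤ a) (ha2 : a ≤ 8 / 7) (hr : 5 ≤ r)
    (hd2 : d ^ 2 ≤ a ^ 2 - 2 * a * (2 / 11) * r + r ^ 2) : d < r - a / 16 := by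
  have ha0 : 0 < a := by linarith
  have hpos : 0 < r - a / 16 := by linarith
  have hlt : d ^ 2 < (r - a / 16) ^ 2 := by nlinarith [mul_le_mul_of_nonneg_left hr ha0.le]
  exact lt_of_pow_lt_pow_left₀ 2 hpos.le hlt

/-- the clean step at ceiling `aHi ≤ 8/7`: from an atom `y` at distance `≥ 5` from `x`, some two-shell neighbour of `y` is strictly closer to `x`
(record `exists_closer_of_clean`: `a ≤ 1`, `dist > 5`). [folklore] -/
theorem exists_closer_of_cleanP (haHi : aHi ≤ 8 / 7) (hC : IsCleanP aHi (μS S)) {x y : E3} (hy : y ∈ S) (hfar : 5 ≤ dist x y) :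
    ∃ z ∈ S, dist x z < dist x y := by
  have hy' : μS S {y} ≠ 0 := (Literature.Probability.Process.count_restrict_singleton_ne_zero_iff S y).2 hy
  obtain ⟨a, ha1, ha2, A, P, f, hP, hf, -, -⟩ := hC y hy'
  rw [setOf_μS_ne_zero] at hf
  set Ae := A.toLinearIsometryEquiv rfl with hAe
  set d : E3 := x - y with hd
  obtain ⟨v, hvP, hv⟩ := exists_inner_ge_of_pattern hP (Ae.symm d)
  have hAd : A (Ae.symm d) = d := by
    have h := LinearIsometryEquiv.apply_symm_apply Ae d
    rw [hAe, LinearIsometry.toLinearIsometryEquiv_apply] at h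
    rw [hAe]
    exact h
  have hAv : ⟪d, A v⟫ = ⟪Ae.symm d, v⟫ := by rw [← A.inner_map_map (Ae.symm d) v, hAd]
  rw [LinearIsometryEquiv.norm_map] at hv
  have hD : ‖d‖ = dist x y := by rw [hd, dist_eq_norm]
  have hvn : ‖v‖ ≤ 3 / 2 := norm_le_of_mem_pattern hP hvP
  have ha0 : 0 < a := by linarith
  have ha87 : a ≤ 8 / 7 := ha2.trans haHi
  obtain ⟨hz, hzd⟩ := hf v hvP
  refine ⟨f v, hz, ?_⟩
  have hmid : dist x (y + a • A v) ≤ dist x y - a / 4 := by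
    have hsq : dist x (y + a • A v) ^ 2 ≤ (dist x y - a / 4) ^ 2 := by
      rw [dist_eq_norm, show x - (y + a • A v) = d - a • A v by rw [hd]; abel, norm_sub_sq_real, real_inner_smul_right,
        norm_smul, A.norm_map, Real.norm_eq_abs, abs_of_pos ha0, hAv, ← hD]
      have h1 : (a * ‖v‖) ^ 2 ≤ (a * (3 / 2)) ^ 2 := by gcongr
      rw [hD] at hv
      nlinarith [mul_le_mul_of_nonneg_left hv ha0.le, mul_le_mul_of_nonneg_left hfar ha0.le, h1, ha87, hD, norm_nonneg v]
    have hnn : 0 ≤ dist x y - a / 4 := by linarith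
    exact (pow_le_pow_iff_left₀ dist_nonneg hnn two_ne_zero).mp hsq
  calc dist x (f v) ≤ dist x (y + a • A v) + dist (y + a • A v) (f v) := dist_triangle _ _ _
    _ ≤ (dist x y - a / 4) + 1 / 16 * a := by rw [dist_comm (y + a • A v)]; exact add_le_add hmid hzd
    _ < dist x y := by linarith

/-- ★ a separated, nonempty, `aHi`-clean set (`aHi ≤ 8/7`) is `5`-relatively dense, STRICTLY: every point of `E3` is within distance `< 5` of
an atom (record: `exists_mem_dist_le_five` / `…CleanCovering.exists_mem_dist_lt_five_of_clean` at ceiling `1`). [folklore] -/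
theorem exists_mem_dist_lt_five_of_cleanP (haHi : aHi ≤ 8 / 7) (hδ : 0 < δ) (hS : IsSep δ S) (hC : IsCleanP aHi (μS S))
    (hne : S.Nonempty) (x : E3) : ∃ y ∈ S, dist x y < 5 := by
  obtain ⟨y₁, hy₁⟩ := hne
  set F := S ∩ closedBall x (dist x y₁) with hF
  have hFfin : F.Finite := finite_sep_inter_closedBall hδ hS x _
  have hFne : F.Nonempty := ⟨y₁, hy₁, by rw [mem_closedBall, dist_comm]⟩
  obtain ⟨y, hyF, hmin⟩ := Set.exists_min_image F (fun y => dist x y) hFfin hFne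
  refine ⟨y, hyF.1, ?_⟩
  by_contra hfar
  push Not at hfar
  obtain ⟨z, hz, hzd⟩ := exists_closer_of_cleanP haHi hC hyF.1 hfar
  have hzF : z ∈ F := by
    refine ⟨hz, ?_⟩
    rw [mem_closedBall, dist_comm]
    have := hmin y₁ ⟨hy₁, by rw [mem_closedBall, dist_comm]⟩
    linarith
  have := hmin z hzF
  linarith

/-- the set-level form consumed by window counting: hypotheses on `S` directly. [folklore] -/
theorem exists_mem_dist_lt_five_of_goodP (haHi : aHi ≤ 8 / 7) (hδ : 0 < δ) (hsep : ∀ x ∈ S, ∀ y ∈ S, x ≠ y → δ ≤ dist x y)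
    (hne : S.Nonempty) (hclean : ∀ q ∈ S, IsTwoShellGoodSet (1 / 16) (9 / 10) aHi S q) (y : E3) : ∃ p ∈ S, dist p y < 5 := by
  obtain ⟨p, hp, hd⟩ := exists_mem_dist_lt_five_of_cleanP haHi hδ hsep ((isCleanP_μS_iff S).2 hclean) hne y
  exact ⟨p, hp, by rwa [dist_comm]⟩

end Density

/-! ## 3. IND from relative density alone, hence at every ceiling `aHi ≤ 8/7` -/

section Main

variable {δ aHi : ℝ} {a b : E3} {w : ℤ → E3}

/-- ★★ **IND from density**: if every point of space is within distance `< 5` of the stacked layered set `Layered a b w`, its in-plane periods are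
linearly independent (the record proof of `linearIndependent_of_clean_stacked`, which consumes cleanliness and separation only through this
density; body verbatim from there). [folklore] -/
theorem linearIndependent_of_dense_stacked (hD : ∀ x : E3, ∃ y ∈ Layered a b w, dist x y < 5) (hst : IsStacked a b w) :
    LinearIndependent ℝ ![a, b] := by
  by_contra hdep
  obtain ⟨c, hc, α, β, ha, hb⟩ := exists_common_line hdep
  obtain ⟨n, hna, hnb, hn⟩ := hst
  have hnc : ⟪n, c⟫ = 0 := by rcases hc with rfl | rfl <;> assumption
  obtain ⟨e, he0, hne, hce⟩ := exists_orthogonal_pair n c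
  have hea : ⟪e, a⟫ = 0 := by rw [ha, real_inner_smul_right, real_inner_comm, hce, mul_zero]
  have heb : ⟪e, b⟫ = 0 := by rw [hb, real_inner_smul_right, real_inner_comm, hce, mul_zero]
  have hn0 : n ≠ 0 := by
    intro h; have := hn 0; rw [h, inner_zero_left] at this; exact lt_irrefl _ this
  have hnpos : 0 < ‖n‖ := norm_pos_iff.mpr hn0
  have hepos : 0 < ‖e‖ := norm_pos_iff.mpr he0
  have hmono := strictMono_height hn
  -- coordinates of atoms along `n` and `e` depend only on the layer
  have hcoord : ∀ y ∈ Layered a b w, ∃ l : ℤ, ⟪n, y⟫ = ⟪n, w l⟫ ∧ ⟪e, y⟫ = ⟪e, w l⟫ := by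
    rintro y ⟨l, i, j, rfl⟩
    refine ⟨l, ?_, ?_⟩
    · simp [inner_add_right, inner_smul_right, hna, hnb]
    · simp [inner_add_right, inner_smul_right, hea, heb]
  have hdense : ∀ x : E3, ∃ y ∈ Layered a b w, dist x y ≤ 5 := fun x => (hD x).imp fun y h => ⟨h.1, h.2.le⟩
  -- escape above and below
  have hself : ⟪n, (11 / ‖n‖) • n⟫ = 11 * ‖n‖ := by
    rw [real_inner_smul_right, real_inner_self_eq_norm_sq]; field_simp
  obtain ⟨yu, hyu, hdu⟩ := hdense ((11 / ‖n‖) • n)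
  obtain ⟨yd, hyd, hdd⟩ := hdense (-((11 / ‖n‖) • n))
  obtain ⟨lu, hlu, -⟩ := hcoord yu hyu
  obtain ⟨ld, hld, -⟩ := hcoord yd hyd
  have hup : 6 * ‖n‖ ≤ ⟪n, w lu⟫ := by
    have h := abs_inner_sub_inner_le (n := n) hdu
    rw [hself, hlu] at h
    have := (abs_le.mp h).1; linarith
  have hdown : ⟪n, w ld⟫ ≤ -(6 * ‖n‖) := by
    have h := abs_inner_sub_inner_le (n := n) hdd
    rw [inner_neg_right, hself, hld] at h
    have := (abs_le.mp h).2; linarith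
  have hwindow : ∀ l : ℤ, |⟪n, w l⟫| ≤ ‖n‖ * 5 → ld < l ∧ l < lu := by
    intro l hl
    obtain ⟨h1, h2⟩ := abs_le.mp hl
    constructor
    · by_contra hle
      push Not at hle
      have h3 : ⟪n, w l⟫ ≤ ⟪n, w ld⟫ := hmono.monotone hle
      linarith
    · by_contra hle
      push Not at hle
      have h3 : ⟪n, w lu⟫ ≤ ⟪n, w l⟫ := hmono.monotone hle
      linarith
  -- probes along `e` at height `0`
  set x : ℕ → E3 := fun k => ((11 * k) / ‖e‖) • e with hx
  have hxe : ∀ k : ℕ, ⟪e, x k⟫ = 11 * k * ‖e‖ := by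
    intro k; rw [hx]; dsimp only; rw [real_inner_smul_right, real_inner_self_eq_norm_sq]; field_simp
  have hxn : ∀ k : ℕ, ⟪n, x k⟫ = 0 := by
    intro k; rw [hx]; dsimp only; rw [real_inner_smul_right, hne, mul_zero]
  choose y hyS hyd5 using fun k => hdense (x k)
  choose l hl using fun k => hcoord (y k) (hyS k)
  have hlwin : ∀ k, l k ∈ Finset.Ioo ld lu := by
    intro k
    rw [Finset.mem_Ioo]
    apply hwindow
    rw [← (hl k).1]
    have h := abs_inner_sub_inner_le (n := n) (hyd5 k)
    rwa [hxn k, sub_zero] at h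
  have hlinj : Function.Injective l := by
    intro k k' hkk
    by_contra hne'
    have hk := abs_inner_sub_inner_le (n := e) (hyd5 k)
    have hk' := abs_inner_sub_inner_le (n := e) (hyd5 k')
    rw [hxe k, (hl k).2, hkk] at hk
    rw [hxe k', (hl k').2] at hk'
    have h3 : |(11 * k * ‖e‖ : ℝ) - 11 * k' * ‖e‖| ≤ ‖e‖ * 5 + ‖e‖ * 5 := by
      calc |(11 * k * ‖e‖ : ℝ) - 11 * k' * ‖e‖|
          = |(⟪e, w (l k')⟫ - 11 * k' * ‖e‖) - (⟪e, w (l k')⟫ - 11 * k * ‖e‖)| := by ring_nf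
        _ ≤ |⟪e, w (l k')⟫ - 11 * k' * ‖e‖| + |⟪e, w (l k')⟫ - 11 * k * ‖e‖| := abs_sub _ _
        _ ≤ ‖e‖ * 5 + ‖e‖ * 5 := add_le_add hk' hk
    have h4 : |(11 * k * ‖e‖ : ℝ) - 11 * k' * ‖e‖| = 11 * ‖e‖ * |(k : ℝ) - k'| := by
      rw [show (11 * k * ‖e‖ : ℝ) - 11 * k' * ‖e‖ = (11 * ‖e‖) * ((k : ℝ) - k') by ring, abs_mul,
        abs_of_pos (by positivity)]
    rw [h4] at h3
    have h5 : (1 : ℝ) ≤ |(k : ℝ) - k'| := by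
      rcases lt_or_gt_of_ne hne' with hlt | hlt
      · have : (k : ℝ) + 1 ≤ k' := by exact_mod_cast hlt
        rw [abs_of_nonpos (by linarith)]; linarith
      · have : (k' : ℝ) + 1 ≤ k := by exact_mod_cast hlt
        rw [abs_of_nonneg (by linarith)]; linarith
    nlinarith
  have hcard := Finset.card_le_card_of_injOn l (s := Finset.range ((lu - ld).toNat + 1)) (t := Finset.Ioo ld lu)
    (fun k _ => Finset.mem_coe.2 (hlwin k)) hlinj.injOn
  rw [Finset.card_range, Int.card_Ioo] at hcard
  omega

/-- ★★ **IND at ceiling `aHi ≤ 8/7`**: the in-plane periods of a `δ`-separated, `aHi`-clean, stacked layered set are linearly independent. -/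
theorem linearIndependent_of_cleanP_stacked (haHi : aHi ≤ 8 / 7) (hδ : 0 < δ) (hS : IsSep δ (Layered a b w))
    (hC : IsCleanP aHi (μS (Layered a b w))) (hst : IsStacked a b w) : LinearIndependent ℝ ![a, b] :=
  linearIndependent_of_dense_stacked
    (fun x => exists_mem_dist_lt_five_of_cleanP haHi hδ hS hC ⟨w 0, 0, 0, 0, by simp⟩ x) hst

/-- ★ packaged in the binder order of `…ProfileSlavingLJLayerBalance.CleanStackedIndependent` with `IsClean ↦ IsCleanP aHi`; at `aHi = 103/100`
the cleanliness binder is lens-4's `IsCleanW (μS (Layered a b w))` by `Iff.rfl`. -/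
theorem cleanStackedIndependentP (haHi : aHi ≤ 8 / 7) :
    ∀ δ : ℝ, 0 < δ → ∀ (a b : E3) (w : ℤ → E3),
      IsSep δ (Layered a b w) → IsCleanP aHi (μS (Layered a b w)) → IsStacked a b w → LinearIndependent ℝ ![a, b] :=
  fun _ hδ _ _ _ hS hC hst => linearIndependent_of_cleanP_stacked haHi hδ hS hC hst

/-- the R1-N instance of record, ceiling `103/100`. -/
theorem cleanStackedIndependentW :
    ∀ δ : ℝ, 0 < δ → ∀ (a b : E3) (w : ℤ → E3),
      IsSep δ (Layered a b w) → IsCleanP (103 / 100) (μS (Layered a b w)) → IsStacked a b w → LinearIndependent ℝ ![a, b] :=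
  cleanStackedIndependentP (by norm_num)

end Main

end Summit.AtomisticToContinuum.Crystallization.Theorems.ChartedPlanarOrderCleanScaleP

end
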